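import Literature.MathematicalPhysics.QuantumFieldTheory.Balaban1983to89.Node00.BgAveragingPrOfRecord
import HarnessLib

/-!
# The scheme letters at the FRAMED triple `(Q^{pr}(U₀), QprimeOfRecord U₀, R(QprimeOfRecord))`: `𝔊^{pr}`, `H₁^{pr}`, `𝔄^{pr}`, `W^{pr}`, the Prop. 4 door letters — edition (ρ-frame-min), file A3

statement-level skeleton of published definitions with citation tags; nothing here is a claim about the Yang–Mills mass gap
(cell `pub-ymgap`, unit `pub-ymgap-node00-def-Y` g40; road (ρ-frame-min) = director №601∕№608; pin choice second-read PASS bus I.13307 (RR-2 READ 12)).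

WHY THIS PIN.  The (45)∕(3.124) engine (lit ✓`B9Eq3124GaugeModes.h124'_RLatticeK`) consumes a PAIR `(Q, Q′)` through (g2) «`Q′λ = 0 → Q(D_{U₀}λ) = 0`»;
the tree has two (g2)-consistent pairs at the record — frame-free `(QOfRecord, Q′♭ = QflatOfRecord)` (centre values; files 3b∕3c `…AtBgFlat`, point-pinned,
per-lattice rows only) and FRAMED `(QprOfRecord U₀ 𝔥, QprimeOfRecord U₀)` (block means, (3.114)) — and print's (45)∕(46)∕(117)∕[Balaban1985BackgroundPropagators]
Thm 3.12 are statements about the framed pair.  This file re-pins the `(Δ₁, Q, Q′)`-GENERIC letters of files 3a∕3b∕3f′ (`frakGOfRecord(At)`, `H1OfRecord(At)`,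
`hessOpOfRecord128`, `DeltaPiCurOfRecord`, lit `W80`, the generic door letters of 3h′) at the framed pair — literally `frakGOfRecordAtBg` ∕ `H1OfRecordAtBg` ∕
`…128` ∕ `WOfRecordAt` ∕ `Prop4…AtRecord` with the `Q`-argument `QOfRecord ↦ QprOfRecord … 𝔥`, the `Q′`-argument `Q′♭ ↦ QprimeOfRecord`, `C^{sl} ↦ C^{sl,pr}`;
`J` (28) and `B` (20) are chart-free and used verbatim.  `hpos` (positivity of (110)'s operator for the pair) and `hQ` (`Q^{pr}(U₀)` onto) stay DISPLAYED binders.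

WHAT IS HERE: `frakGprOfRecordAtBg`, `H1prOfRecordAtBg` (+ `_eq`), `frakGprOfRecordAtBg128`, `H1prOfRecordAtBg128`, `frakAprOfRecordAtBg128`, `WprOfRecordAt`,
`Prop4UniformPrAtRecord`, `Prop4LetterHPrAtRecord`, `Prop4LetterCPrAtRecord`, `Prop4LetterSymmPrAtRecord`, `Prop4LetterColumnsPrAtRecord`, and the glue
`prop4UniformPrAtRecord_of_letters` (3h′'s `quadAnalytic_W80_of_letters` once more: `WprOfRecordAt` IS lit's `W80` at the framed slots, `rfl`).

HONEST: definitions and one glue line; nothing of (46)∕(117)∕Thm 3.12 is asserted; the frame-free files stay (USE-HELD for k-uniform rows, live per lattice);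
COUNT∕K unchanged; finite `𝕋⁴` at fixed `ε`; nothing continuum ∕ OS ∕ Clay; no instance, no notation, no `sorry`.
-/


noncomputable section

open scoped Matrix Matrix.Norms.L2Operator InnerProductSpace ComplexConjugate Topology

namespace Literature.MathematicalPhysics.QuantumFieldTheory.Balaban1983to89.Node00

open T4Continuum BlockAveraging
open B4Sect5Torus (TSite)
open B9SectCLatticeCarrier (Bond)
open B9Eq311L2Pairing (WL2)
open B11Eq103H1Complex (SiteL2K BondL2K covDerivL2K)
open B11Eq115Space (NegSize NegSup levWeight)
open B11Eq111FrakG (nabla115)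
open NormedSpace (exp)
open MatrixLog (mlog mlog_one analyticAt_mlog)
open B15AveragingHolomorphic (iterMh loopMh loopMh_coeField coeField_avgFamily_eq_iterMh)
open B15AveragingAnalytic (analyticAt_iterMh_of_polydisc)
open B15DeterminingSets (embIter)
open B13Contraction113 (QuadAnalytic)
open B11Prop6Scheme (Prop4Hyp)

/-! ## §1. The H₁ triple at the framed pair — files 3b∕3f′'s pins with the `Q`∕`Q′`-arguments swapped -/

section Record

variable (F : T4Family) (N : ℕ) [NeZero N] (K : ℕ) (k : ℕ) (Ω : ℕ → Set (Site (F.P K) 0)) (U₀ : GaugeField (F.P K) 0 (SU N))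


/-- ★★★ **`𝔊(U₀)` OF RECORD AT THE FRAMED TRIPLE, SLOT (a)**: `frakGOfRecord` (file 3a) at `(QprOfRecord U₀ 𝔥, QprimeOfRecord U₀)`; data `a`; displayed
proofs `hpos` ([Balaban1985BackgroundPropagators] Thm 3.11 for this pair) and `hQ` (`Q^{pr}(U₀)` onto).  Literally `frakGOfRecordAtBg` with the Q-argument swapped.
[cite: Balaban1985Variational, (110)–(111) p.294, (116)–(117) p.295; Balaban1985BackgroundPropagators, Thm 3.11 p.416, (3.19) p.393, (3.113) p.418] -/
def frakGprOfRecordAtBg [Fact (0 < (F.L : ℝ))] [Fact (0 < (F.P K).eta k)] [Fact (0 < c0Rec F K k)] [Fact (∀ c, 0 < wBRec F K k c)]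
    (𝔥 : FrameDatum (F.P K) N k U₀) (a : ℝ)
    (hpos : ∀ x, x ≠ 0 → 0 < RCLike.re ⟪x, laplaceAOfRecord F N k U₀ (QprOfRecord F N k U₀ 𝔥) (QprimeOfRecord F N k U₀) a x⟫_ℂ)
    (hQ : Function.Surjective (QprOfRecord F N k U₀ 𝔥)) :
    NegSizeLit F N K k Ω 3 →L[ℂ] Space115Lit F N K k Ω U₀ :=
  frakGOfRecord F N K k Ω U₀ (QprOfRecord F N k U₀ 𝔥) (QprimeOfRecord F N k U₀) a hpos hQ

/-- **`H₁(U₀)` OF RECORD AT THE FRAMED TRIPLE, SLOT (a)** (block levels `levB` a datum).  Literally `H1OfRecordAtBg` with the Q-argument swapped.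
[cite: Balaban1985Variational, (45) p.285, (103) p.293, (174) p.305; Balaban1985BackgroundPropagators, (3.113) p.418] -/
def H1prOfRecordAtBg [Fact (0 < (F.L : ℝ))] [Fact (0 < (F.P K).eta k)] [Fact (0 < c0Rec F K k)] [Fact (∀ c, 0 < wBRec F K k c)]
    (𝔥 : FrameDatum (F.P K) N k U₀) (levB : PBond (F.P K) k → ℕ) (a : ℝ)
    (hpos : ∀ x, x ≠ 0 → 0 < RCLike.re ⟪x, laplaceAOfRecord F N k U₀ (QprOfRecord F N k U₀ 𝔥) (QprimeOfRecord F N k U₀) a x⟫_ℂ)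
    (hQ : Function.Surjective (QprOfRecord F N k U₀ 𝔥)) :
    NegSize (F.L : ℝ) ((F.P K).eta k) levB 0 (Matrix (Fin N) (Fin N) ℂ) →L[ℂ] Space115Lit F N K k Ω U₀ :=
  H1OfRecord F N K k Ω U₀ levB (QprOfRecord F N k U₀ 𝔥) (QprimeOfRecord F N k U₀) a hpos hQ

/-- Unfolding (`rfl`). [cite: Balaban1985Variational, (103) p.293 (bookkeeping)] -/
theorem H1prOfRecordAtBg_eq [Fact (0 < (F.L : ℝ))] [Fact (0 < (F.P K).eta k)] [Fact (0 < c0Rec F K k)] [Fact (∀ c, 0 < wBRec F K k c)]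
    (𝔥 : FrameDatum (F.P K) N k U₀) (levB : PBond (F.P K) k → ℕ) (a : ℝ)
    (hpos : ∀ x, x ≠ 0 → 0 < RCLike.re ⟪x, laplaceAOfRecord F N k U₀ (QprOfRecord F N k U₀ 𝔥) (QprimeOfRecord F N k U₀) a x⟫_ℂ)
    (hQ : Function.Surjective (QprOfRecord F N k U₀ 𝔥)) :
    H1prOfRecordAtBg F N K k Ω U₀ 𝔥 levB a hpos hQ =
      H1OfRecord F N K k Ω U₀ levB (QprOfRecord F N k U₀ 𝔥) (QprimeOfRecord F N k U₀) a hpos hQ := rfl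

/-- ★ **`𝔊(U₀)` OF RECORD AT THE FRAMED TRIPLE, SLOT (c)**: `frakGOfRecordAt` at the Hessian `π†(Δ(U₀) + Δ⁽²⁾)π` with `π` built from `QprimeOfRecord`
(file 3f′'s `hessOpOfRecord128 … Gp (QprimeOfRecord …) Δ2`), `Q := QprOfRecord U₀ 𝔥`, `Q′ := QprimeOfRecord U₀`.
[cite: Balaban1985Variational, (110)–(111) p.294, (116)–(117) p.295; Balaban1985BackgroundPropagators, (3.122) p.420, (3.128) p.421, Thm 3.12 p.421] -/
def frakGprOfRecordAtBg128 [Fact (0 < (F.L : ℝ))] [Fact (0 < (F.P K).eta k)] [Fact (0 < c0Rec F K k)] [Fact (∀ c, 0 < wBRec F K k c)]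
    (𝔥 : FrameDatum (F.P K) N k U₀)
    (Gp : SiteL2K ℂ (F.P K).d (fun _ => (F.P K).sitesPerDir 0) (c0Rec F K k) (WRec N) →ₗ[ℂ]
      SiteL2K ℂ (F.P K).d (fun _ => (F.P K).sitesPerDir 0) (c0Rec F K k) (WRec N))
    (Δ2 : BondL2K ℂ (F.P K).d (fun _ => (F.P K).sitesPerDir 0) (c0Rec F K k) (WRec N) →ₗ[ℂ]
      BondL2K ℂ (F.P K).d (fun _ => (F.P K).sitesPerDir 0) (c0Rec F K k) (WRec N)) (a : ℝ)
    (hpos : ∀ x, x ≠ 0 → 0 < RCLike.re ⟪x, laplaceAOfRecordAt F N k U₀ (hessOpOfRecord128 F N k U₀ Gp (QprimeOfRecord F N k U₀) Δ2)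
      (QprOfRecord F N k U₀ 𝔥) (QprimeOfRecord F N k U₀) a x⟫_ℂ)
    (hQ : Function.Surjective (QprOfRecord F N k U₀ 𝔥)) : NegSizeLit F N K k Ω 3 →L[ℂ] Space115Lit F N K k Ω U₀ :=
  frakGOfRecordAt F N K k Ω U₀ (hessOpOfRecord128 F N k U₀ Gp (QprimeOfRecord F N k U₀) Δ2) (QprOfRecord F N k U₀ 𝔥) (QprimeOfRecord F N k U₀) a hpos hQ

/-- ★ **`H₁(U₀)` OF RECORD AT THE FRAMED TRIPLE, SLOT (c)**. [cite: Balaban1985Variational, (102)–(103) p.293, (110) p.294; Balaban1985BackgroundPropagators, (3.128)–(3.129) p.421] -/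
def H1prOfRecordAtBg128 [Fact (0 < (F.L : ℝ))] [Fact (0 < (F.P K).eta k)] [Fact (0 < c0Rec F K k)] [Fact (∀ c, 0 < wBRec F K k c)]
    (𝔥 : FrameDatum (F.P K) N k U₀) (levB : PBond (F.P K) k → ℕ)
    (Gp : SiteL2K ℂ (F.P K).d (fun _ => (F.P K).sitesPerDir 0) (c0Rec F K k) (WRec N) →ₗ[ℂ]
      SiteL2K ℂ (F.P K).d (fun _ => (F.P K).sitesPerDir 0) (c0Rec F K k) (WRec N))
    (Δ2 : BondL2K ℂ (F.P K).d (fun _ => (F.P K).sitesPerDir 0) (c0Rec F K k) (WRec N) →ₗ[ℂ]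
      BondL2K ℂ (F.P K).d (fun _ => (F.P K).sitesPerDir 0) (c0Rec F K k) (WRec N)) (a : ℝ)
    (hpos : ∀ x, x ≠ 0 → 0 < RCLike.re ⟪x, laplaceAOfRecordAt F N k U₀ (hessOpOfRecord128 F N k U₀ Gp (QprimeOfRecord F N k U₀) Δ2)
      (QprOfRecord F N k U₀ 𝔥) (QprimeOfRecord F N k U₀) a x⟫_ℂ)
    (hQ : Function.Surjective (QprOfRecord F N k U₀ 𝔥)) :
    NegSize (F.L : ℝ) ((F.P K).eta k) levB 0 (Matrix (Fin N) (Fin N) ℂ) →L[ℂ] Space115Lit F N K k Ω U₀ :=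
  H1OfRecordAt F N K k Ω U₀ levB (hessOpOfRecord128 F N k U₀ Gp (QprimeOfRecord F N k U₀) Δ2) (QprOfRecord F N k U₀ 𝔥) (QprimeOfRecord F N k U₀) a hpos hQ

/-- ★ **`𝔄 = H₁B` AT THE FRAMED TRIPLE, SLOT (c)** — `B = BOfRecord` (20) is chart-free and used verbatim. [cite: Balaban1985Variational, (103) p.293, (20) p.281, (116) p.295] -/
def frakAprOfRecordAtBg128 [Fact (0 < (F.L : ℝ))] [Fact (0 < (F.P K).eta k)] [Fact (0 < c0Rec F K k)] [Fact (∀ c, 0 < wBRec F K k c)]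
    (𝔥 : FrameDatum (F.P K) N k U₀) (levB : PBond (F.P K) k → ℕ)
    (Gp : SiteL2K ℂ (F.P K).d (fun _ => (F.P K).sitesPerDir 0) (c0Rec F K k) (WRec N) →ₗ[ℂ]
      SiteL2K ℂ (F.P K).d (fun _ => (F.P K).sitesPerDir 0) (c0Rec F K k) (WRec N))
    (Δ2 : BondL2K ℂ (F.P K).d (fun _ => (F.P K).sitesPerDir 0) (c0Rec F K k) (WRec N) →ₗ[ℂ]
      BondL2K ℂ (F.P K).d (fun _ => (F.P K).sitesPerDir 0) (c0Rec F K k) (WRec N)) (a : ℝ)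
    (hpos : ∀ x, x ≠ 0 → 0 < RCLike.re ⟪x, laplaceAOfRecordAt F N k U₀ (hessOpOfRecord128 F N k U₀ Gp (QprimeOfRecord F N k U₀) Δ2)
      (QprOfRecord F N k U₀ 𝔥) (QprimeOfRecord F N k U₀) a x⟫_ℂ)
    (hQ : Function.Surjective (QprOfRecord F N k U₀ 𝔥)) (V : GaugeField (F.P K) k (SU N)) : Space115Lit F N K k Ω U₀ :=
  H1prOfRecordAtBg128 F N K k Ω U₀ 𝔥 levB Gp Δ2 a hpos hQ (BOfRecord F N K k U₀ levB V)

/-! ## §2. `W^{pr}` of (80)∕(84)–(96) at the framed slots -/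

/-- ★★ **`W^{pr}` OF (80)∕(84)–(96) AT THE FRAMED SLOTS** — lit's `W80` with `H := H1prOfRecordAtBg`, `C := CslprOfRecord`, `J := JOfRecordAtBg` (chart-free),
`Δπ := DeltaPiCurOfRecord Gp (QprimeOfRecord U₀)`. A definition; (46) ∕ the Sect. C regime are NOT asserted.
[cite: Balaban1985Variational, (80) p.290, (84) p.290, (85)–(96) pp.291–292, (45)–(47) p.285] -/
def WprOfRecordAt [Fact (0 < (F.L : ℝ))] [Fact (0 < (F.P K).eta k)] [Fact (0 < c0Rec F K k)] [Fact (∀ c, 0 < wBRec F K k c)]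
    (𝔥 : FrameDatum (F.P K) N k U₀) (levB : PBond (F.P K) k → ℕ) (a : ℝ)
    (hpos : ∀ x, x ≠ 0 → 0 < RCLike.re ⟪x, laplaceAOfRecord F N k U₀ (QprOfRecord F N k U₀ 𝔥) (QprimeOfRecord F N k U₀) a x⟫_ℂ)
    (hQ : Function.Surjective (QprOfRecord F N k U₀ 𝔥)) (εC : ℝ)
    (Gp : SiteL2K ℂ (F.P K).d (fun _ => (F.P K).sitesPerDir 0) (c0Rec F K k) (WRec N) →ₗ[ℂ]
      SiteL2K ℂ (F.P K).d (fun _ => (F.P K).sitesPerDir 0) (c0Rec F K k) (WRec N)) :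
    Space115Lit F N K k Ω U₀ → NegSizeLit F N K k Ω 3 :=
  B11Eq80Current.W80 (rhoRec N) (tauRecCLM N) (unitsOfRecord F N U₀) (H1prOfRecordAtBg F N K k Ω U₀ 𝔥 levB a hpos hQ)
    (CslprOfRecord F N K k Ω U₀ 𝔥 levB) εC (JOfRecordAtBg F N K k Ω U₀) (DeltaPiCurOfRecord F N K k Ω U₀ Gp (QprimeOfRecord F N k U₀))

/-! ### The door letters of Prop. 4 at the framed slots (one-liners over the generic letters of file 3h′) -/

variable [Fact (0 < (F.L : ℝ))] [Fact (0 < (F.P K).eta k)] [Fact (0 < c0Rec F K k)] [Fact (∀ c, 0 < wBRec F K k c)]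

/-- ★ **THE (R2) TARGET LETTER AT THE FRAMED SLOTS** — [B11] Prop. 4 (97)–(98) for `W^{pr}`. DISPLAYED. [cite: Balaban1985Variational, Prop. 4 (97)–(98) pp.292–293] -/
def Prop4UniformPrAtRecord (𝔥 : FrameDatum (F.P K) N k U₀) (levB : PBond (F.P K) k → ℕ) (a : ℝ)
    (hpos : ∀ x, x ≠ 0 → 0 < RCLike.re ⟪x, laplaceAOfRecord F N k U₀ (QprOfRecord F N k U₀ 𝔥) (QprimeOfRecord F N k U₀) a x⟫_ℂ)
    (hQ : Function.Surjective (QprOfRecord F N k U₀ 𝔥)) (εC : ℝ)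
    (Gp : SiteL2K ℂ (F.P K).d (fun _ => (F.P K).sitesPerDir 0) (c0Rec F K k) (WRec N) →ₗ[ℂ]
      SiteL2K ℂ (F.P K).d (fun _ => (F.P K).sitesPerDir 0) (c0Rec F K k) (WRec N)) (C₄ R' : ℝ) : Prop :=
  QuadAnalytic (WprOfRecordAt F N K k Ω U₀ 𝔥 levB a hpos hQ εC Gp) C₄ R' ∧
    AnalyticOnNhd ℂ (WprOfRecordAt F N K k Ω U₀ 𝔥 levB a hpos hQ εC Gp) {Y : Space115Lit F N K k Ω U₀ | ‖Y‖ < R'}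

/-- (ℓa-H) at the framed slots: `‖H₁^{pr}(U₀) X‖ ≤ b‖X‖` — the row print's (46)∕(117)∕[B9] Thm 3.12 are about. DISPLAYED. [cite: Balaban1985Variational, (45)–(46) p.285, (117) p.295] -/
def Prop4LetterHPrAtRecord (𝔥 : FrameDatum (F.P K) N k U₀) (levB : PBond (F.P K) k → ℕ) (a : ℝ)
    (hpos : ∀ x, x ≠ 0 → 0 < RCLike.re ⟪x, laplaceAOfRecord F N k U₀ (QprOfRecord F N k U₀ 𝔥) (QprimeOfRecord F N k U₀) a x⟫_ℂ)
    (hQ : Function.Surjective (QprOfRecord F N k U₀ 𝔥)) (b : ℝ) : Prop :=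
  Prop4LetterH (H1prOfRecordAtBg F N K k Ω U₀ 𝔥 levB a hpos hQ) b

/-- (ℓa-C) at the framed slots: `Prop4Hyp (CslprOfRecord … 𝔥 levB) C₂ c₄`. DISPLAYED. [cite: Balaban1985Variational, (44) p.285, (49) p.285] -/
def Prop4LetterCPrAtRecord (𝔥 : FrameDatum (F.P K) N k U₀) (levB : PBond (F.P K) k → ℕ) (C₂ c₄ : ℝ) : Prop :=
  Prop4Hyp (CslprOfRecord F N K k Ω U₀ 𝔥 levB) C₂ c₄

/-- (ℓc) at the framed slots: the (27)-symmetry of `DeltaPiCurOfRecord … Gp (QprimeOfRecord U₀)`. DISPLAYED. [cite: Balaban1985Variational, (27) p.282] -/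
def Prop4LetterSymmPrAtRecord
    (Gp : SiteL2K ℂ (F.P K).d (fun _ => (F.P K).sitesPerDir 0) (c0Rec F K k) (WRec N) →ₗ[ℂ]
      SiteL2K ℂ (F.P K).d (fun _ => (F.P K).sitesPerDir 0) (c0Rec F K k) (WRec N)) : Prop :=
  Prop4LetterSymm (tauRecCLM N) (DeltaPiCurOfRecord F N K k Ω U₀ Gp (QprimeOfRecord F N k U₀))

/-- (ℓd) at the framed slots: `N₁`, `θ_E`, `θ_E′`, `θ₃` for `H := H1prOfRecordAtBg …`, `C := CslprOfRecord …`, `Δπ` at `QprimeOfRecord`. DISPLAYED.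
[cite: Balaban1985Variational, (86)–(89) p.291] -/
def Prop4LetterColumnsPrAtRecord (𝔥 : FrameDatum (F.P K) N k U₀) (levB : PBond (F.P K) k → ℕ) (a : ℝ)
    (hpos : ∀ x, x ≠ 0 → 0 < RCLike.re ⟪x, laplaceAOfRecord F N k U₀ (QprOfRecord F N k U₀ 𝔥) (QprimeOfRecord F N k U₀) a x⟫_ℂ)
    (hQ : Function.Surjective (QprOfRecord F N k U₀ 𝔥)) (εC : ℝ)
    (Gp : SiteL2K ℂ (F.P K).d (fun _ => (F.P K).sitesPerDir 0) (c0Rec F K k) (WRec N) →ₗ[ℂ]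
      SiteL2K ℂ (F.P K).d (fun _ => (F.P K).sitesPerDir 0) (c0Rec F K k) (WRec N)) (R' θ₃ θE θE' N₁ : ℝ) : Prop :=
  Prop4LetterColumns (H1prOfRecordAtBg F N K k Ω U₀ 𝔥 levB a hpos hQ) (CslprOfRecord F N K k Ω U₀ 𝔥 levB) εC
    (DeltaPiCurOfRecord F N K k Ω U₀ Gp (QprimeOfRecord F N k U₀)) R' θ₃ θE θE' N₁

/-- ★★ **PROP. 4 AT THE FRAMED SLOTS FROM ITS NAMED LETTERS** — file 3h′'s `quadAnalytic_W80_of_letters` once more (`WprOfRecordAt` IS `W80` at the framed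
slots, `rfl`).  Glue. [cite: Balaban1985Variational, Prop. 4 (97)–(98) pp.292–293] -/
theorem prop4UniformPrAtRecord_of_letters (𝔥 : FrameDatum (F.P K) N k U₀) (levB : PBond (F.P K) k → ℕ) (a : ℝ)
    (hpos : ∀ x, x ≠ 0 → 0 < RCLike.re ⟪x, laplaceAOfRecord F N k U₀ (QprOfRecord F N k U₀ 𝔥) (QprimeOfRecord F N k U₀) a x⟫_ℂ)
    (hQ : Function.Surjective (QprOfRecord F N k U₀ 𝔥)) {εC : ℝ}
    (Gp : SiteL2K ℂ (F.P K).d (fun _ => (F.P K).sitesPerDir 0) (c0Rec F K k) (WRec N) →ₗ[ℂ]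
      SiteL2K ℂ (F.P K).d (fun _ => (F.P K).sitesPerDir 0) (c0Rec F K k) (WRec N))
    {b C₂ c₄ aC CV RV R' θ₃ θE θE' N₁ : ℝ}
    (hH : Prop4LetterHPrAtRecord F N K k Ω U₀ 𝔥 levB a hpos hQ b) (hC : Prop4LetterCPrAtRecord F N K k Ω U₀ 𝔥 levB C₂ c₄)
    (hnum : Prop4LetterNum b C₂ c₄ aC εC RV R') (hV : Prop4LetterV0AtRecord F N K k Ω U₀ CV RV) (hsym : Prop4LetterSymmPrAtRecord F N K k Ω U₀ Gp)
    (hcol : Prop4LetterColumnsPrAtRecord F N K k Ω U₀ 𝔥 levB a hpos hQ εC Gp R' θ₃ θE θE' N₁) :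
    Prop4UniformPrAtRecord F N K k Ω U₀ 𝔥 levB a hpos hQ εC Gp
      (c4OfRecord N ‖JOfRecordAtBg F N K k Ω U₀‖ b C₂ εC aC CV R' θ₃ θE θE' N₁) R' :=
  quadAnalytic_W80_of_letters (rhoRec N) (tauRecCLM N) (unitsOfRecord F N U₀) (JOfRecordAtBg F N K k Ω U₀)
    (DeltaPiCurOfRecord F N K k Ω U₀ Gp (QprimeOfRecord F N k U₀)) hH hC hnum hV hsym hcol

end Record

end Literature.MathematicalPhysics.QuantumFieldTheory.Balaban1983to89.Node00

end
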